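import Literature.MathematicalPhysics.QuantumFieldTheory.Balaban1983to89.B8Eq191FlatDirichletDepth
import Literature.MathematicalPhysics.QuantumFieldTheory.Balaban1983to89.B8Eq191FlatDirichletLipschitzExponent

/-!
# `Balaban1983to89.B8Eq191FlatDirichletCollarDecay` — [Balaban1985RegularSpaces] (1.101) p. 93 AT `U₀ = 1` WITH DIRICHLET CONDITIONS, THE DEPTH DIRECTION: THE FLAT
# DIRICHLET MULTI-LEVEL GREEN'S FUNCTION ON THE CUBE MEMBER `{□_j}` DECAYS EXPONENTIALLY IN THE NUMBER OF COLLARS CROSSED — `e^{2δ′ρ(m−1)}·(1−θ)²·Σ_{level ≤ J} ω g² ≤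
# Σ ω⁻¹f²` for `Kg = f` with `f` supported at levels `≥ J + m` ([B5] p. 36's exponential conjugation in [4] (3.47)'s weights along [B6] (2.46)'s distance; bricks 1–4b of the
# (R1′) programme of DAG node N05 composed)

statement-level skeleton of published theorems with citation tags; proofs where landed; nothing here is a claim about the
Yang–Mills mass gap

T. Bałaban, *Spaces of regular gauge field configurations …*, Commun. Math. Phys. **99** (1985) 75–102 `[Balaban1985RegularSpaces]` ("B8"): (1.101) p. 93 («G′ is a bounded
operator from a space with the norm |·|₍₋₂₎ into a space with the norm |·|»), (1.131) p. 99, p. 98; [4] = `[Balaban1985BackgroundPropagators]` Thm 3.1 (3.47) p. 398;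
[B5] = `[Balaban1984PropagatorsI]` p. 36, (1.114) p. 36 (the localised bounds); [B6] = `[Balaban1984PropagatorsII]` p. 228 («G(Ω) … minor and obvious changes»), (2.2)
p. 224, (2.46) p. 231, Lemma 2.1 (2.60)–(2.61) p. 234 («sup_{y∈𝔅} Σ_{y′∈𝔅} e^{−αδ₀d(y,y′)} ≤ c₁(α)»).

CITATION HEADER (lean-in-tree rule).  Cell `pub-ymgap` (YM Track A, HUMAN RULING D-0062), DAG node N05 = [B8], seat `pub-ymgap-dag-n05-c` (g8), programme (R1′) = the
three REAL families of `B8Prop6CubeMemberFlatScalar.prop6_cubeMember_flat_of_real` (memo `R1PRIME-PROGRAMME.md`, seat HOME).  THIS FILE closes the DEPTH half of the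
decay mechanism behind (1.101) on the consumer's own carrier: brick 1's weighted lower bound + brick 2's conjugation∕Agmon solve + brick 3's bond-Lipschitz exponents +
brick 4a's tower-scaled site distance (to a SET, §1 here) + brick 4b's collar lower bound.  What remains for (1.101) is the LATERAL half (the counting lemma (2.61) on the
cube member under the margin threshold of bus «LOCATED-ρ») and the `ℓ² → ℓ^∞` step — bricks 4c∕5.

WHAT THIS FILE PROVES (theorems only; 0 `def`).
* §1 THE DISTANCE TO A SET `d_σ(A, z) = min_{x₀∈A} d_σ(x₀, z)` (as `Finset.inf'`): `setDist_nonneg`, `setDist_eq_zero_of_mem`, ★ `abs_setDist_sub_setDist_le` (bond-Lipschitz),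
  ★ `lipschitz_of_setDist` (`ρ′ = c·d_σ(A,·)`, `|c| ≤ δ′` is an admissible exponent of brick 3 when `σ ≤ L⁻ʲ` at level-`j` sites).
* §2 ★★★ **`collarDecay_cubeMember`** — for the cube member (`S = □₀`, truncation `n ≤ k`, collar width `ρ ≥ L`), letters `K` at `(η, L, n, cubeLamS, w)`, weights
  `w′_j ∈ [a₀, 8]`, `w_j > 0`, `Kg = f` on `□₀`, `f` supported in `A ⊂ □₀` with all sites of `A` at tower level `≥ J + m`:
  `exp(2δ′ρ(m − 1))·(1 − θ)²·Σ_{z∈□₀ : level(z) ≤ J} ω(z)g(z)² ≤ Σ_{z∈□₀} ω(z)⁻¹f(z)²`, `ω(z) = min{8,w′_{j(z)}}(L^{j(z)}η)⁻²`, any `δ′` with `δ′ ≤ 1`, `dδ′ ≤ 1`,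
  `4dδ′² ≤ θa₀`, `2d²δ′² ≤ θ < 1` — uniform in `k, η, M, n` and the cube's position.  Proof: `agmon_solve_cubeMember_of_lipschitz` with `ρ′ = δ′·d_σ(A,·)` (zero on the
  source, `≥ δ′ρ(m−1)` on the shallow sites by `lsDist_ge_collars`).

HONEST SCOPE.  A weighted-`ℓ²` statement, NOT the pointwise (1.101); the constants are explicit but not optimised; the lateral direction and the sup norm are open
(bricks 4c∕5, see the memo and bus «ROUTE QUESTION» l.19680 on waking r05's torus generators instead).  Count-neutral; N05 NOT discharged; one finite `T⁴` programme at
fixed `ε`, Bałaban as printed; nothing continuum ∕ ℝ⁴ ∕ OS ∕ mass-gap ∕ Clay.  No `sorry`, no `def`, no `instance`, no `notation`.  Unit `pub-ymgap-dag-n05-c` (g8), 2026-08-27.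

RELATED IN THE TREE, NOT DUPLICATED: `B5CombesThomasKernel.local_decay` (one-scale localised `L²` bound `Σ_{ρ ≥ R}(Gg)² ≤ e^{−2δR}(2∕γ)²‖g‖²` on the torus — the one-level
model of this statement), r05's `B8Ineq198MultiLevelTorus*` ((1.101) in sup norms on p21's torus carrier, levels ≥ 1, no Dirichlet level 0 — other carrier, other norm).
-/

noncomputable section

namespace Literature.MathematicalPhysics.QuantumFieldTheory.Balaban1983to89.B8Eq191FlatDirichletCollarDecay

open Finset
open B7Prop1Explicit (e)
open Literature.MathematicalPhysics.QuantumLattice (blockMap)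
open B8Eq131CubesAdmissible (cubeFam)
open B8CubeMemberZd (cubeLamS)
open B8Eq191FlatDirichletDistance (nnGraph lsDist lsDist_nonneg lsDist_self abs_lsDist_sub_lsDist_le towerScale_eq towerScale_nonneg adj_add_e adj_sub_e)
open B8Eq191FlatDirichletDepth (lsDist_ge_collars)
open B8Eq191FlatDirichletLipschitzExponent (agmon_solve_cubeMember_of_lipschitz)
open B8Eq191FlatDirichletConjugation (cover_cubeMember)
open B8Eq191FlatLettersCubeMember (towers_disjoint_cube)
open B8Eq191FlatDirichletCoercive (towerBlock_subset_cube)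

variable {d : ℕ}

/-! ## §1 The scaled distance TO A SET `A` (as `Finset.inf'` of the point distances): zero on `A`, bond-Lipschitz -/

variable (S : Finset (Fin d → ℤ)) {σ : (Fin d → ℤ) → ℝ}

/-- The distance to a nonempty set is non-negative. [cite: Balaban1984PropagatorsII, (2.46) p.231] -/
theorem setDist_nonneg (hσ : ∀ x, 0 ≤ σ x) (A : Finset (Fin d → ℤ)) (hA : A.Nonempty) (z : Fin d → ℤ) :
    0 ≤ A.inf' hA (fun x₀ => lsDist S σ x₀ z) :=
  (Finset.le_inf'_iff hA _).mpr fun x₀ _ => lsDist_nonneg S hσ x₀ z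

/-- The distance to `A` vanishes on `A`. [cite: Balaban1984PropagatorsII, (2.46) p.231] -/
theorem setDist_eq_zero_of_mem (hσ : ∀ x, 0 ≤ σ x) (A : Finset (Fin d → ℤ)) (hA : A.Nonempty) {z : Fin d → ℤ} (hz : z ∈ A) :
    A.inf' hA (fun x₀ => lsDist S σ x₀ z) = 0 :=
  le_antisymm ((Finset.inf'_le _ hz).trans (le_of_eq (lsDist_self S hσ z))) (setDist_nonneg S hσ A hA z)

/-- **BOND-LIPSCHITZ for the distance to a set**: `|d(A,x) − d(A,z)| ≤ min(σ x, σ z)` across every bond. [cite: Balaban1984PropagatorsII, (2.46) p.231] -/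
theorem abs_setDist_sub_setDist_le (hσ : ∀ x, 0 ≤ σ x) (A : Finset (Fin d → ℤ)) (hA : A.Nonempty) {x z : Fin d → ℤ} (h : (nnGraph S).Adj x z) :
    |A.inf' hA (fun x₀ => lsDist S σ x₀ x) - A.inf' hA (fun x₀ => lsDist S σ x₀ z)| ≤ min (σ x) (σ z) := by
  -- `inf'` of pointwise-close families is close
  have key : ∀ (u v : (Fin d → ℤ) → ℝ) (c : ℝ), (∀ x₀ ∈ A, u x₀ ≤ v x₀ + c) → A.inf' hA u ≤ A.inf' hA v + c := by
    intro u v c huv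
    obtain ⟨x₀, hx₀, hmin⟩ := Finset.exists_mem_eq_inf' hA v
    rw [hmin]
    exact (Finset.inf'_le u hx₀).trans (huv x₀ hx₀)
  have h1 := key (fun x₀ => lsDist S σ x₀ x) (fun x₀ => lsDist S σ x₀ z) (min (σ x) (σ z))
    fun x₀ _ => by have := abs_lsDist_sub_lsDist_le S hσ x₀ h; rw [abs_sub_le_iff] at this; linarith [this.1]
  have h2 := key (fun x₀ => lsDist S σ x₀ z) (fun x₀ => lsDist S σ x₀ x) (min (σ x) (σ z))
    fun x₀ _ => by have := abs_lsDist_sub_lsDist_le S hσ x₀ h; rw [abs_sub_le_iff] at this; linarith [this.2]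
  rw [abs_sub_le_iff]; constructor <;> linarith

/-- **Admissible exponents from the distance to a set**: if `σ ≤ L⁻ʲ` at level-`j` tower sites then `ρ = c·d_σ(A, ·)`, `|c| ≤ δ′`, is bond-Lipschitz at the tower scale
(the `hlip` hypothesis of `B8Eq191FlatDirichletLipschitzExponent`). [cite: Balaban1984PropagatorsII, (2.46) p.231; Balaban1984PropagatorsI, p.36] -/
theorem lipschitz_of_setDist (hσ : ∀ x, 0 ≤ σ x) (L m : ℕ) (Λs : ℕ → Set (Fin d → ℤ))
    (hσL : ∀ x ∈ S, ∀ j, j ≤ m → blockMap (L ^ j) x ∈ Λs j → σ x ≤ (((L : ℝ) ^ j))⁻¹)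
    (A : Finset (Fin d → ℤ)) (hA : A.Nonempty) {c δ' : ℝ} (hc : |c| ≤ δ') :
    ∀ x ∈ S, ∀ j, j ≤ m → blockMap (L ^ j) x ∈ Λs j → ∀ μ : Fin d,
      (x + e μ ∈ S → |c * A.inf' hA (fun x₀ => lsDist S σ x₀ x) - c * A.inf' hA (fun x₀ => lsDist S σ x₀ (x + e μ))| ≤ δ' * (((L : ℝ) ^ j))⁻¹) ∧
      (x - e μ ∈ S → |c * A.inf' hA (fun x₀ => lsDist S σ x₀ x) - c * A.inf' hA (fun x₀ => lsDist S σ x₀ (x - e μ))| ≤ δ' * (((L : ℝ) ^ j))⁻¹) := by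
  intro x hx j hj hxj μ
  have key : ∀ z, (nnGraph S).Adj x z →
      |c * A.inf' hA (fun x₀ => lsDist S σ x₀ x) - c * A.inf' hA (fun x₀ => lsDist S σ x₀ z)| ≤ δ' * (((L : ℝ) ^ j))⁻¹ := by
    intro z hz
    rw [← mul_sub, abs_mul]
    have h1 := abs_setDist_sub_setDist_le S hσ A hA hz
    have h2 : min (σ x) (σ z) ≤ (((L : ℝ) ^ j))⁻¹ := (min_le_left _ _).trans (hσL x hx j hj hxj)
    exact mul_le_mul hc (h1.trans h2) (abs_nonneg _) ((abs_nonneg c).trans hc)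
  exact ⟨fun h => key _ (adj_add_e S hx μ h), fun h => key _ (adj_sub_e S hx μ h)⟩

/-! ## §2 THE INTER-COLLAR DECAY of the flat Dirichlet multi-level Green's function on the cube member -/

open Classical in
/-- **INTER-COLLAR DECAY OF THE FLAT DIRICHLET MULTI-LEVEL GREEN'S FUNCTION** (bricks 1–4b composed; [B5] p. 36's exponential conjugation in [4] (3.47)'s weights with
[B6] (2.46)'s distance, AT `U₀ = 1`, Dirichlet on `□₀ᶜ`).  Cube member `{□_j}` (`S = □₀`, truncation `n ≤ k`, collar width `ρ ≥ L`), kernel letters `K` at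
`(η, L, n, cubeLamS, w)` of `B8Prop6CubeMemberFlatScalar.prop6_cubeMember_flat_of_real`, level weights `w′_j = w_jη²L^{2j}L^{−dj} ∈ [a₀, 8]`, `w_j > 0`; `Kg = f` on
`□₀` with `g` supported in `□₀` and the SOURCE `f` supported in a set `A` of sites of tower level `≥ J + m`.  Then the solution on the sites of level `≤ J` is
exponentially small in the number of collars crossed:
`e^{2δ′ρ(m − 1)}·(1 − θ)²·Σ_{z ∈ □₀, level(z) ≤ J} ω(z)g(z)² ≤ Σ_{z∈□₀} ω(z)⁻¹f(z)²`, `ω(z) = min{8,w′_{j(z)}}(L^{j(z)}η)⁻²`, for every `δ′` with `δ′ ≤ 1`, `dδ′ ≤ 1`,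
`4dδ′² ≤ θa₀`, `2d²δ′² ≤ θ < 1` — uniform in `k`, `η`, `M`, `n`, and the position of the cube.
[cite: Balaban1985RegularSpaces, (1.101) p.93, (1.131) p.99, p.98; Balaban1985BackgroundPropagators, Thm 3.1 (3.47) p.398; Balaban1984PropagatorsI, p.36, (1.114) p.36; Balaban1984PropagatorsII, p.228, (2.2) p.224, (2.46) p.231, Lemma 2.1 (2.60)–(2.61) p.234] -/
theorem collarDecay_cubeMember (hd : 0 < d) {η : ℝ} (hη : η ≠ 0) {L : ℕ} (hL : 1 ≤ L) (a : Fin d → ℤ) (M : ℕ) {ρ : ℕ} (hρ : L ≤ ρ)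
    {k n : ℕ} (hn : n ≤ k) (w : ℕ → ℝ) (hw : ∀ j, 0 < w j) (S : Finset (Fin d → ℤ)) (hS : ∀ x, x ∈ S ↔ x ∈ cubeFam false L a M ρ k 0)
    (K : (Fin d → ℤ) → (Fin d → ℤ) → ℝ)
    (hK : ∀ x z, K x z = ((η ^ 2)⁻¹ * ∑ μ : Fin d, ((2 : ℝ) * (if z = x then (1 : ℝ) else 0) - (if z = x + e μ then (1 : ℝ) else 0)
        - (if z = x - e μ then (1 : ℝ) else 0))) +
        (∑ j ∈ Finset.range (n + 1), (if blockMap (L ^ j) x ∈ cubeLamS L a M ρ k n j ∧ blockMap (L ^ j) z = blockMap (L ^ j) x then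
          w j * ((((L : ℝ) ^ d)⁻¹) ^ j) ^ 2 else 0)))
    {a₀ : ℝ} (ha₀ : 0 ≤ a₀) (hlo : ∀ j, j ≤ n → a₀ ≤ w j * η ^ 2 * ((L : ℝ) ^ j) ^ 2 * (((L : ℝ) ^ d) ^ j)⁻¹)
    (hhi : ∀ j, j ≤ n → w j * η ^ 2 * ((L : ℝ) ^ j) ^ 2 * (((L : ℝ) ^ d) ^ j)⁻¹ ≤ 8)
    {δ' θ : ℝ} (hδ0 : 0 ≤ δ') (hδ1 : δ' ≤ 1) (hδd : (d : ℝ) * δ' ≤ 1) (hδa : 4 * (d : ℝ) * δ' ^ 2 ≤ θ * a₀)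
    (hδθ : 2 * (d : ℝ) ^ 2 * δ' ^ 2 ≤ θ) (hθ1 : θ < 1)
    (g f : (Fin d → ℤ) → ℝ) (hg : ∀ x, x ∉ S → g x = 0) (hKg : ∀ x ∈ S, ∑ z ∈ S, K x z * g z = f x)
    (A : Finset (Fin d → ℤ)) (hA : A.Nonempty) (hAS : A ⊆ S) {J m : ℕ}
    (hfA : ∀ z ∈ S, f z ≠ 0 → z ∈ A)
    (hAlev : ∀ x₀ ∈ A, ∃ j, J + m ≤ j ∧ j ≤ n ∧ blockMap (L ^ j) x₀ ∈ cubeLamS L a M ρ k n j) :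
    Real.exp (2 * δ' * ρ * ((m : ℝ) - 1)) * (1 - θ) ^ 2 *
        ∑ z ∈ S.filter (fun z => ∃ j, j ≤ J ∧ blockMap (L ^ j) z ∈ cubeLamS L a M ρ k n j),
          (∑ j ∈ Finset.range (n + 1), (if blockMap (L ^ j) z ∈ cubeLamS L a M ρ k n j then
            min 8 (w j * η ^ 2 * ((L : ℝ) ^ j) ^ 2 * (((L : ℝ) ^ d) ^ j)⁻¹) * (((L : ℝ) ^ j * η) ^ 2)⁻¹ else 0)) * g z ^ 2
      ≤ ∑ z ∈ S, (∑ j ∈ Finset.range (n + 1), (if blockMap (L ^ j) z ∈ cubeLamS L a M ρ k n j then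
            min 8 (w j * η ^ 2 * ((L : ℝ) ^ j) ^ 2 * (((L : ℝ) ^ d) ^ j)⁻¹) * (((L : ℝ) ^ j * η) ^ 2)⁻¹ else 0))⁻¹ * f z ^ 2 := by
  -- the tower scale and the exponent `ρ′ = δ′ · d_σ(A, ·)`
  set σ : (Fin d → ℤ) → ℝ := fun y => ∑ j' ∈ Finset.range (n + 1),
    (if blockMap (L ^ j') y ∈ cubeLamS L a M ρ k n j' then (((L : ℝ) ^ j'))⁻¹ else 0) with hσdef
  set D : (Fin d → ℤ) → ℝ := fun z => A.inf' hA (fun x₀ => lsDist S σ x₀ z) with hDdef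
  set Ω : (Fin d → ℤ) → ℝ := fun z => ∑ j ∈ Finset.range (n + 1), (if blockMap (L ^ j) z ∈ cubeLamS L a M ρ k n j then
      min 8 (w j * η ^ 2 * ((L : ℝ) ^ j) ^ 2 * (((L : ℝ) ^ d) ^ j)⁻¹) * (((L : ℝ) ^ j * η) ^ 2)⁻¹ else 0) with hΩdef
  have hσ0 : ∀ x, 0 ≤ σ x := fun x => towerScale_nonneg L n (cubeLamS L a M ρ k n) x
  have hdisj : ∀ x ∈ S, ∀ j, j ≤ n → ∀ j', j' ≤ n → blockMap (L ^ j) x ∈ cubeLamS L a M ρ k n j →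
      blockMap (L ^ j') x ∈ cubeLamS L a M ρ k n j' → j = j' :=
    fun x hx j hj j' hj' h1 h2 => (towers_disjoint_cube hL a M hρ hn j hj j' hj' _ h1 _ h2 x ((hS x).mp hx) rfl rfl).1
  have hσL : ∀ x ∈ S, ∀ j, j ≤ n → blockMap (L ^ j) x ∈ cubeLamS L a M ρ k n j → σ x ≤ (((L : ℝ) ^ j))⁻¹ :=
    fun x hx j hj hxj => le_of_eq (towerScale_eq S L n (cubeLamS L a M ρ k n) hdisj hx hj hxj)
  -- the Agmon estimate for `ρ′ = δ′ · D`
  have hlip := lipschitz_of_setDist S hσ0 L n (cubeLamS L a M ρ k n) hσL A hA (c := δ') (δ' := δ') (le_of_eq (abs_of_nonneg hδ0))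
  have hmain := agmon_solve_cubeMember_of_lipschitz hη hL a M hρ hn w hw S hS K hK ha₀ hlo hhi (fun z => δ' * D z)
    hδ0 hδ1 hδd hδa hδθ hθ1 hlip g f hg hKg
  -- weights are non-negative
  have hΩ0 : ∀ z, 0 ≤ Ω z := fun z => Finset.sum_nonneg fun j _ => by
    split_ifs
    · exact mul_nonneg (le_min (by norm_num) (by have := (hw j).le; positivity)) (by positivity)
    · exact le_rfl
  -- RHS: the exponent vanishes on the source set
  have hR : ∑ z ∈ S, (Ω z)⁻¹ * Real.exp (2 * (δ' * D z)) * f z ^ 2 = ∑ z ∈ S, (Ω z)⁻¹ * f z ^ 2 := by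
    refine Finset.sum_congr rfl fun z hz => ?_
    by_cases hf : f z = 0
    · rw [hf]; ring
    · have hD0 : D z = 0 := setDist_eq_zero_of_mem S hσ0 A hA (hfA z hz hf)
      rw [hD0, mul_zero, mul_zero, Real.exp_zero, mul_one]
  -- LHS: on the shallow sites the exponent is at least `2δ′ρ(m − 1)`
  have hlow : ∀ z ∈ S.filter (fun z => ∃ j, j ≤ J ∧ blockMap (L ^ j) z ∈ cubeLamS L a M ρ k n j),
      Real.exp (2 * δ' * ρ * ((m : ℝ) - 1)) ≤ Real.exp (2 * (δ' * D z)) := by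
    intro z hz
    obtain ⟨hzS, jz, hjzJ, hzj⟩ := Finset.mem_filter.mp hz
    refine Real.exp_le_exp.mpr ?_
    have hD : (ρ : ℝ) * ((m : ℝ) - 1) ≤ D z := by
      refine (Finset.le_inf'_iff hA _).mpr fun x₀ hx₀ => ?_
      obtain ⟨jx, hjxm, hjxn, hxj⟩ := hAlev x₀ hx₀
      have hjz : jz ≤ n := by
        rcases le_or_gt jz n with h | h
        · exact h
        · exact absurd hzj (by rw [B8CubeMemberZd.cubeLamS_of_gt L a M ρ k h]; exact fun h' => h')
      have h1 := lsDist_ge_collars hd hL a M hρ hn S hS (hAS hx₀) hzS hjxn hjz hxj hzj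
      have h2 : (m : ℝ) - 1 ≤ |(jx : ℝ) - jz| - 1 := by
        have : (m : ℝ) ≤ (jx : ℝ) - jz := by
          have : J + m ≤ jx := hjxm
          have : (jz : ℝ) ≤ J := by exact_mod_cast hjzJ
          have : ((J + m : ℕ) : ℝ) ≤ jx := by exact_mod_cast hjxm
          push_cast at this; linarith
        linarith [le_abs_self ((jx : ℝ) - jz)]
      have hρ0 : (0 : ℝ) ≤ ρ := by positivity
      calc (ρ : ℝ) * ((m : ℝ) - 1) ≤ (ρ : ℝ) * (|(jx : ℝ) - jz| - 1) := mul_le_mul_of_nonneg_left h2 hρ0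
        _ ≤ _ := h1
    nlinarith [hD, hδ0]
  -- assemble
  have hL1 : Real.exp (2 * δ' * ρ * ((m : ℝ) - 1)) *
      ∑ z ∈ S.filter (fun z => ∃ j, j ≤ J ∧ blockMap (L ^ j) z ∈ cubeLamS L a M ρ k n j), Ω z * g z ^ 2
      ≤ ∑ z ∈ S, Ω z * Real.exp (2 * (δ' * D z)) * g z ^ 2 := by
    rw [Finset.mul_sum]
    calc ∑ z ∈ S.filter (fun z => ∃ j, j ≤ J ∧ blockMap (L ^ j) z ∈ cubeLamS L a M ρ k n j), Real.exp (2 * δ' * ρ * ((m : ℝ) - 1)) * (Ω z * g z ^ 2)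
        ≤ ∑ z ∈ S.filter (fun z => ∃ j, j ≤ J ∧ blockMap (L ^ j) z ∈ cubeLamS L a M ρ k n j), Ω z * Real.exp (2 * (δ' * D z)) * g z ^ 2 := by
          refine Finset.sum_le_sum fun z hz => ?_
          have := mul_le_mul_of_nonneg_left (hlow z hz) (mul_nonneg (hΩ0 z) (sq_nonneg (g z)))
          linarith [this]
      _ ≤ ∑ z ∈ S, Ω z * Real.exp (2 * (δ' * D z)) * g z ^ 2 :=
          Finset.sum_le_sum_of_subset_of_nonneg (Finset.filter_subset _ _) fun z _ _ =>
            mul_nonneg (mul_nonneg (hΩ0 z) (Real.exp_pos _).le) (sq_nonneg _)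
  have h1θ : 0 ≤ (1 - θ) ^ 2 := sq_nonneg _
  have hmain' : (1 - θ) ^ 2 * ∑ z ∈ S, Ω z * Real.exp (2 * (δ' * D z)) * g z ^ 2 ≤ ∑ z ∈ S, (Ω z)⁻¹ * f z ^ 2 := by
    rw [← hR]; exact hmain
  calc Real.exp (2 * δ' * ρ * ((m : ℝ) - 1)) * (1 - θ) ^ 2 *
        ∑ z ∈ S.filter (fun z => ∃ j, j ≤ J ∧ blockMap (L ^ j) z ∈ cubeLamS L a M ρ k n j), Ω z * g z ^ 2
      = (1 - θ) ^ 2 * (Real.exp (2 * δ' * ρ * ((m : ℝ) - 1)) *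
          ∑ z ∈ S.filter (fun z => ∃ j, j ≤ J ∧ blockMap (L ^ j) z ∈ cubeLamS L a M ρ k n j), Ω z * g z ^ 2) := by ring
    _ ≤ (1 - θ) ^ 2 * ∑ z ∈ S, Ω z * Real.exp (2 * (δ' * D z)) * g z ^ 2 := mul_le_mul_of_nonneg_left hL1 h1θ
    _ ≤ ∑ z ∈ S, (Ω z)⁻¹ * f z ^ 2 := hmain'

end Literature.MathematicalPhysics.QuantumFieldTheory.Balaban1983to89.B8Eq191FlatDirichletCollarDecay

end
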